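import Literature.MathematicalPhysics.QuantumLattice.DWaveSourceProofs
import Literature.MathematicalPhysics.QuantumLattice.FinDimSpectrumProofs
import Literature.MathematicalPhysics.QuantumLattice.HubbardWave0RepulsiveProofs
import Literature.MathematicalPhysics.QuantumLattice.HubbardWave0LiebProofs
import Literature.MathematicalPhysics.QuantumLattice.Su2Multiplet
import Literature.MathematicalPhysics.QuantumLattice.HubbardOneParticleCost
import Literature.MathematicalPhysics.QuantumLattice.HubbardUniformOneParticleCost
import Literature.MathematicalPhysics.QuantumLattice.SectorSpectrum
import Summits.HubbardSuperconductivity.HubbardSuperconductivity.Theorems.ThermalWedgeTwSeededEnsembleEquivalencePairFieldSinglet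
import Summits.HubbardSuperconductivity.HubbardSuperconductivity.Theorems.WcbcsSsbToTorusLRO.Negative.BlockRepulsionDominatesPairOrder
import HarnessLib

/-!
# Route `AposterioriCapRg` — crux `SsbToEvenTorusLro` (stmt-HubbardSuperconductivity-1315),
# line `number-projected-canonical-slope`, stub `stub_projectedChord` — helper file 1/2:
# a spin-balanced unit ground vector of the SOURCED torus and its three inequalities

For the sourced grand-canonical Hubbard torus `T_h = dWaveSourceTorus L U μ h = K_μ − h(P + Pᴴ)`
(`P = pairField dWaveFormFactor L`, `K_μ = hubbardTorusWith 2 L 1 U μ`) we prove: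

* `pc_exists_groundVector_spinZ_small` — for ANY Hermitian matrix on the Hubbard Fock space commuting
  with `S⁺` and `S⁻`, the ground eigenspace contains a UNIT vector `φ` with `S^z φ = (e/2) φ`, `e ∈ {0, 1}`
  (an `S^z`-eigenvector exists in the `S^±`-stable ground space — `Module.End.exists_eigenvalue` on the
  restriction — its weight is a half-integer, and the `su(2)` descent `‖S⁻v‖² = ‖S⁺v‖² + 2m‖v‖²`
  (`IsSu2Triple.eq_zero_of_M_eq_zero`, `weight_M`, `weight_P`, mirror triple) lowers `|2m|` two units at
  a time); `pc_exists_sourced_groundVector` — the instance `T_h` (`[T_h, S^±] = 0`: Lieb's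
  `hamiltonian_commute_spinPlus`, `totalNumber_mul_spinPlus`, the landed `stub_pairFieldSinglet`).
* `pc_re_pairField_ge` — ONE FIELD-STEP UP: every unit ground vector `φ` of `T_h` has
  `Re⟨φ, Pφ⟩ ≥ L² · dWaveSourceDensity L U μ s` for every `s < h` (variational principle with `φ` at
  field `s` + the tracial chord `dWaveSourceDensity_mul_le_groundEnergy_drop`).
* `pc_blockCoherence_ge` — for `0 ≤ s < h`: `Re⟨φ, W_R φ⟩ ≥ L² · dWaveSourceDensity L U μ s ²`
  (`W_R = R⁻⁴ Σ_a B_aᴴ B_a` the Kac block operator; block domination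
  `re_expect_pairIntensity_le_sq_mul_blockRepulsion` — `L² W_R ≥ PᴴP` — and Cauchy–Schwarz).
* `pc_re_hubbardTorusWith_le` — `Re⟨φ, K_μ φ⟩ ≤ E₀(K_μ) + 2h‖P + Pᴴ‖`-type bound
  `≤ E₀(K_μ) + 2·h·(2Σ_e|d(e)/√2|)·2·L²` for `h ≥ 0` (`groundEnergy_dWaveSourceTorus_le`, `norm_pairField_le`).

All folklore finite-dimensional linear algebra (Tasaki 2020 §2.1, §2.4; Koma–Tasaki 1994 §1); no definition
is introduced.
-/

noncomputable section

namespace Summit.HubbardSuperconductivity.HubbardSuperconductivity.Theorems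

set_option linter.dupNamespace false

open Literature.MathematicalPhysics.QuantumLattice Literature.Probability.LatticeModels Matrix
open Literature.MathematicalPhysics.QuantumLattice.ThermodynamicLimit
open scoped Matrix ComplexOrder ComplexConjugate Matrix.Norms.L2Operator InnerProductSpace

/-! ### The abstract `su(2)` descent inside a ground eigenspace -/

section Descent

variable {L : ℕ}

/-- Invariance of the ground eigenspace under a commuting matrix. [folklore] -/
theorem pc_groundSpace_mulVec_mem {A X : Matrix (Finset (Orb (FermionTorus 2 L))) (Finset (Orb (FermionTorus 2 L))) ℂ}
    (hX : Commute A X) {v : Fock (Orb (FermionTorus 2 L))} (hv : v ∈ A.groundSpace) : X *ᵥ v ∈ A.groundSpace := by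
  rw [mem_groundSpace_iff] at hv ⊢
  rw [mulVec_mulVec, hX.eq, ← mulVec_mulVec, hv, mulVec_smul]

/-- `S^z = ½ (S⁺S⁻ − S⁻S⁺)` commutes with everything commuting with `S⁺` and `S⁻`. [folklore] -/
theorem pc_commute_spinZ_of_commute {A : Matrix (Finset (Orb (FermionTorus 2 L))) (Finset (Orb (FermionTorus 2 L))) ℂ}
    (hP : Commute A spinPlus) (hM : Commute A spinMinus) : Commute A HubbardWave0.spinZ := by
  have h2 : (2 : ℂ) • (HubbardWave0.spinZ : Matrix (Finset (Orb (FermionTorus 2 L))) (Finset (Orb (FermionTorus 2 L))) ℂ) =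
      spinPlus * spinMinus - spinMinus * spinPlus := LiebTwo.isSu2Triple_spin.comm_PM.symm
  have hc : Commute A ((2 : ℂ) • HubbardWave0.spinZ) := by
    rw [h2]
    exact (hP.mul_right hM).sub_right (hM.mul_right hP)
  have e : (HubbardWave0.spinZ : Matrix (Finset (Orb (FermionTorus 2 L))) (Finset (Orb (FermionTorus 2 L))) ℂ) =
      (1 / 2 : ℂ) • ((2 : ℂ) • HubbardWave0.spinZ) := by
    rw [smul_smul]; norm_num
  rw [e]
  exact hc.smul_right _

/-- An `S^z`-stable nonzero subspace of the Hubbard Fock space contains an `S^z`-eigenvector, and its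
eigenvalue is a half-integer `q/2`. [folklore] -/
theorem pc_exists_spinZ_eigenvector {V : Submodule ℂ (Fock (Orb (FermionTorus 2 L)))} (hV : V ≠ ⊥)
    (hZ : ∀ v ∈ V, HubbardWave0.spinZ *ᵥ v ∈ V) :
    ∃ v ∈ V, v ≠ 0 ∧ ∃ q : ℤ, HubbardWave0.spinZ *ᵥ v = ((q : ℂ) / 2) • v := by
  classical
  haveI : Nontrivial V := Submodule.nontrivial_iff_ne_bot.2 hV
  set f : Fock (Orb (FermionTorus 2 L)) →ₗ[ℂ] Fock (Orb (FermionTorus 2 L)) := Matrix.toLin' (HubbardWave0.spinZ : Matrix _ _ ℂ) with hf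
  have hfV : ∀ v ∈ V, f v ∈ V := fun v hv => by
    rw [hf, Matrix.toLin'_apply]; exact hZ v hv
  obtain ⟨c, hc⟩ := Module.End.exists_eigenvalue (f.restrict hfV)
  obtain ⟨x, hx⟩ := hc.exists_hasEigenvector
  have hx1 : (f.restrict hfV) x = c • x := Module.End.mem_eigenspace_iff.1 hx.1
  have hx0 : (x : Fock (Orb (FermionTorus 2 L))) ≠ 0 := fun h => hx.2 (Subtype.ext h)
  have hZx : HubbardWave0.spinZ *ᵥ (x : Fock (Orb (FermionTorus 2 L))) = c • (x : Fock (Orb (FermionTorus 2 L))) := by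
    have := congrArg Subtype.val hx1
    rw [LinearMap.restrict_apply] at this
    simpa [hf, Matrix.toLin'_apply] using this
  -- the eigenvalue is a half-integer: read it off a nonzero coordinate
  obtain ⟨s, hs⟩ := Function.ne_iff.1 hx0
  have hcoord := congrFun hZx s
  rw [LiebThm1.spinZ_mulVec_apply, Pi.smul_apply, smul_eq_mul] at hcoord
  have hc' : c = (1 / 2 : ℂ) * (((upPart s).card : ℂ) - ((downPart s).card : ℂ)) :=
    mul_right_cancel₀ hs hcoord.symm
  refine ⟨x, x.2, hx0, ((upPart s).card : ℤ) - (downPart s).card, ?_⟩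
  rw [hZx, hc']
  congr 1
  push_cast
  ring

/-- One step DOWN: for `q ≥ 1`, `S⁻` maps a nonzero weight-`q/2` vector of an `S⁻`-stable subspace to a
nonzero weight-`(q−2)/2` vector (`‖S⁻v‖² = ‖S⁺v‖² + q‖v‖²`). [folklore] -/
theorem pc_step_down {V : Submodule ℂ (Fock (Orb (FermionTorus 2 L)))}
    (hM : ∀ v ∈ V, spinMinus *ᵥ v ∈ V) {v : Fock (Orb (FermionTorus 2 L))} (hv : v ∈ V) (hv0 : v ≠ 0) {q : ℤ}
    (hq : 1 ≤ q) (hZ : HubbardWave0.spinZ *ᵥ v = ((q : ℂ) / 2) • v) :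
    spinMinus *ᵥ v ∈ V ∧ spinMinus *ᵥ v ≠ 0 ∧
      HubbardWave0.spinZ *ᵥ (spinMinus *ᵥ v) = (((q - 2 : ℤ) : ℂ) / 2) • (spinMinus *ᵥ v) := by
  have h := (LiebTwo.isSu2Triple_spin (Λ := FermionTorus 2 L))
  refine ⟨hM v hv, fun h0 => hv0 ?_, ?_⟩
  · have hZ' : HubbardWave0.spinZ *ᵥ v = (((q : ℝ) / 2 : ℝ) : ℂ) • v := by
      rw [hZ]; push_cast; rfl
    have hpos : (0 : ℝ) < (q : ℝ) / 2 := by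
      have h1 : (1 : ℝ) ≤ q := by exact_mod_cast hq
      linarith
    exact h.eq_zero_of_M_eq_zero hpos hZ' h0
  · rw [h.weight_M hZ]
    congr 1
    push_cast
    ring

/-- One step UP: for `q ≤ −1`, `S⁺` maps a nonzero weight-`q/2` vector of an `S⁺`-stable subspace to a
nonzero weight-`(q+2)/2` vector (mirror triple). [folklore] -/
theorem pc_step_up {V : Submodule ℂ (Fock (Orb (FermionTorus 2 L)))}
    (hP : ∀ v ∈ V, spinPlus *ᵥ v ∈ V) {v : Fock (Orb (FermionTorus 2 L))} (hv : v ∈ V) (hv0 : v ≠ 0) {q : ℤ}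
    (hq : q ≤ -1) (hZ : HubbardWave0.spinZ *ᵥ v = ((q : ℂ) / 2) • v) :
    spinPlus *ᵥ v ∈ V ∧ spinPlus *ᵥ v ≠ 0 ∧
      HubbardWave0.spinZ *ᵥ (spinPlus *ᵥ v) = (((q + 2 : ℤ) : ℂ) / 2) • (spinPlus *ᵥ v) := by
  have h := (LiebTwo.isSu2Triple_spin (Λ := FermionTorus 2 L))
  have h' := h.mirror
  refine ⟨hP v hv, fun h0 => hv0 ?_, ?_⟩
  · have hZ' : (-HubbardWave0.spinZ) *ᵥ v = (((-(q : ℝ)) / 2 : ℝ) : ℂ) • v := by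
      rw [neg_mulVec, hZ, ← neg_smul]; push_cast; ring_nf
    have hpos : (0 : ℝ) < (-(q : ℝ)) / 2 := by
      have h1 : (q : ℝ) ≤ -1 := by exact_mod_cast hq
      linarith
    exact h'.eq_zero_of_M_eq_zero hpos hZ' h0
  · rw [h.weight_P hZ]
    congr 1
    push_cast
    ring

/-- The descent: an `S^±`-stable subspace containing a nonzero vector of half-integer weight `q/2` contains a
nonzero vector of weight `0` or `½`. [folklore] -/
theorem pc_descent {V : Submodule ℂ (Fock (Orb (FermionTorus 2 L)))}
    (hP : ∀ v ∈ V, spinPlus *ᵥ v ∈ V) (hM : ∀ v ∈ V, spinMinus *ᵥ v ∈ V) :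
    ∀ (k : ℕ) (q : ℤ), q.natAbs ≤ k → ∀ v ∈ V, v ≠ 0 → HubbardWave0.spinZ *ᵥ v = ((q : ℂ) / 2) • v →
      ∃ w ∈ V, w ≠ 0 ∧ ∃ e : ℕ, e ≤ 1 ∧ HubbardWave0.spinZ *ᵥ w = ((e : ℂ) / 2) • w := by
  intro k
  induction k using Nat.strong_induction_on with
  | _ k ih =>
    intro q hqk v hv hv0 hZ
    by_cases hq2 : 2 ≤ q
    · obtain ⟨hv', hv0', hZ'⟩ := pc_step_down hM hv hv0 (by omega) hZ
      exact ih (q - 2).natAbs (by omega) (q - 2) le_rfl _ hv' hv0' hZ'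
    by_cases hq2' : q ≤ -2
    · obtain ⟨hv', hv0', hZ'⟩ := pc_step_up hP hv hv0 (by omega) hZ
      exact ih (q + 2).natAbs (by omega) (q + 2) le_rfl _ hv' hv0' hZ'
    by_cases hq1 : q = -1
    · subst hq1
      obtain ⟨hv', hv0', hZ'⟩ := pc_step_up hP hv hv0 le_rfl hZ
      refine ⟨_, hv', hv0', 1, le_rfl, ?_⟩
      rw [hZ']; norm_num
    -- `q ∈ {0, 1}`
    obtain ⟨e, rfl⟩ : ∃ e : ℕ, (e : ℤ) = q := ⟨q.toNat, by omega⟩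
    refine ⟨v, hv, hv0, e, by omega, ?_⟩
    rw [hZ, Int.cast_natCast]

/-- **A unit ground vector with `S^z ∈ {0, ½}`.** For a Hermitian matrix `A` on the Hubbard Fock space commuting
with `S⁺` and `S⁻`, there is a unit ground-state vector `φ` of `A` with `S^z φ = (e/2) φ`, `e ∈ {0, 1}`.
Tasaki (2020) §2.4, Appendix A.3 (raising/lowering inside an `SU(2)`-invariant eigenspace). [folklore] -/
theorem pc_exists_groundVector_spinZ_small {A : Matrix (Finset (Orb (FermionTorus 2 L))) (Finset (Orb (FermionTorus 2 L))) ℂ}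
    (hA : A.IsHermitian) (hP : Commute A spinPlus) (hM : Commute A spinMinus) :
    ∃ φ : Fock (Orb (FermionTorus 2 L)), A.IsGroundStateVector φ ∧ star φ ⬝ᵥ φ = 1 ∧
      ∃ e : ℕ, e ≤ 1 ∧ HubbardWave0.spinZ *ᵥ φ = (((e : ℝ) / 2 : ℝ) : ℂ) • φ := by
  classical
  have hV : A.groundSpace ≠ ⊥ := groundSpace_ne_bot_holds hA
  have hZc : Commute A HubbardWave0.spinZ := pc_commute_spinZ_of_commute hP hM
  obtain ⟨v, hv, hv0, q, hZ⟩ := pc_exists_spinZ_eigenvector hV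
    (fun v hv => pc_groundSpace_mulVec_mem hZc hv)
  obtain ⟨w, hw, hw0, e, he, hZw⟩ := pc_descent (fun v hv => pc_groundSpace_mulVec_mem hP hv)
    (fun v hv => pc_groundSpace_mulVec_mem hM hv) q.natAbs q le_rfl v hv hv0 hZ
  obtain ⟨c, hc0, hc1⟩ := exists_smul_unit hw0
  refine ⟨c • w, ⟨smul_ne_zero hc0 hw0, ?_⟩, hc1, e, he, ?_⟩
  · exact (mem_groundSpace_iff A _).1 (A.groundSpace.smul_mem c hw)
  · rw [mulVec_smul, hZw, smul_comm]
    congr 1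
    push_cast
    ring

end Descent

/-! ### The sourced torus: a spin-balanced unit ground vector and its inequalities -/

section Sourced

variable (L : ℕ) [NeZero L]

/-- `T_h = K_μ − h(P + Pᴴ)` commutes with `S⁺`. [folklore] -/
theorem pc_commute_dWaveSourceTorus_spinPlus (U μ h : ℝ) :
    Commute (dWaveSourceTorus L U μ h) spinPlus := by
  have hH : Commute (hubbardTorus 2 L 1 U) spinPlus :=
    LiebThm1.hamiltonian_commute_spinPlus (fermionTorusGraph 2 L) 1 U
  have hN : Commute (totalNumber : Matrix (Finset (Orb (FermionTorus 2 L))) _ ℂ) spinPlus :=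
    LiebTwo.totalNumber_mul_spinPlus
  obtain ⟨hPp, hPm⟩ :=
    TwSeededEnsembleEquivalence.ExposedDensity.stub_pairFieldSinglet dWaveFormFactor L
  have hPh : Commute (pairField dWaveFormFactor L)ᴴ spinPlus := by
    have := hPm
    rw [Commute, SemiconjBy] at this ⊢
    have h' := congrArg conjTranspose this
    rw [conjTranspose_mul, conjTranspose_mul, spinMinus, conjTranspose_conjTranspose] at h'
    exact h'.symm
  rw [dWaveSourceTorus_eq, hubbardTorusWith_eq]
  exact (hH.sub_left (hN.smul_left _)).sub_left ((hPp.add_left hPh).smul_left _)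

/-- `T_h` commutes with `S⁻`. [folklore] -/
theorem pc_commute_dWaveSourceTorus_spinMinus (U μ h : ℝ) :
    Commute (dWaveSourceTorus L U μ h) spinMinus := by
  have hT : (dWaveSourceTorus L U μ h).IsHermitian :=
    dWaveSourceTorus_isHermitian L (isHermitian_hubbardTorusWith L 1 U μ) h
  have h1 := pc_commute_dWaveSourceTorus_spinPlus L U μ h
  rw [Commute, SemiconjBy] at h1 ⊢
  have h' := congrArg conjTranspose h1
  rw [conjTranspose_mul, conjTranspose_mul, hT.eq] at h'
  rw [spinMinus]
  exact h'.symm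

/-- **A spin-balanced unit ground vector of the sourced torus**: `T_h` has a unit ground-state vector `φ` with
`S^z φ = (e/2) φ`, `e ∈ {0, 1}`. [folklore] -/
theorem pc_exists_sourced_groundVector (U μ h : ℝ) :
    ∃ φ : Fock (Orb (FermionTorus 2 L)), (dWaveSourceTorus L U μ h).IsGroundStateVector φ ∧
      star φ ⬝ᵥ φ = 1 ∧ ∃ e : ℕ, e ≤ 1 ∧ HubbardWave0.spinZ *ᵥ φ = (((e : ℝ) / 2 : ℝ) : ℂ) • φ :=
  pc_exists_groundVector_spinZ_small
    (dWaveSourceTorus_isHermitian L (isHermitian_hubbardTorusWith L 1 U μ) h)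
    (pc_commute_dWaveSourceTorus_spinPlus L U μ h) (pc_commute_dWaveSourceTorus_spinMinus L U μ h)

variable {L}

/-- `T_s = T_h + (h − s)(P + Pᴴ)`. [folklore] -/
theorem pc_dWaveSourceTorus_shift (U μ h s : ℝ) :
    dWaveSourceTorus L U μ s = dWaveSourceTorus L U μ h +
      ((h - s : ℝ) : ℂ) • (pairField dWaveFormFactor L + (pairField dWaveFormFactor L)ᴴ) := by
  rw [dWaveSourceTorus_eq, dWaveSourceTorus_eq, Complex.ofReal_sub, sub_smul]
  abel

/-- `Re⟨φ, Pᴴ φ⟩ = Re⟨φ, P φ⟩`. [folklore] -/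
theorem pc_re_conjTranspose_expect {m : Type*} [Fintype m] (P : Matrix m m ℂ) (φ : m → ℂ) :
    (star φ ⬝ᵥ (Pᴴ *ᵥ φ)).re = (star φ ⬝ᵥ (P *ᵥ φ)).re := by
  rw [← star_mulVec_dotProduct, star_dotProduct (P *ᵥ φ) φ]
  simp only [Complex.star_def, Complex.conj_re]

/-- The Rayleigh quotient of a ground-state vector is the ground energy times the norm. [folklore] -/
theorem pc_re_expect_of_isGroundStateVector {m : Type*} [Fintype m] [DecidableEq m] {A : Matrix m m ℂ}
    {φ : m → ℂ}
    (hφ : A.IsGroundStateVector φ) (h1 : star φ ⬝ᵥ φ = 1) :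
    (star φ ⬝ᵥ (A *ᵥ φ)).re = A.groundEnergy := by
  rw [hφ.2, dotProduct_smul, h1, smul_eq_mul, mul_one, Complex.ofReal_re]

/-- **One field-step up.** Every unit ground vector `φ` of `T_h` has `Re⟨φ, Pφ⟩ ≥ L² · dens_L(s)` for `s < h`:
`E(s) ≤ ⟨φ, T_s φ⟩ = E(h) + (h − s)·2Re⟨φ, Pφ⟩` and `(h − s)·2L²·dens_L(s) ≤ E(s) − E(h)` (tracial chord).
Koma–Tasaki (1994) §1 (monotone supergradients of the concave sourced energy). [folklore] -/
theorem pc_re_pairField_ge {U μ h s : ℝ} {φ : Fock (Orb (FermionTorus 2 L))}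
    (hφ : (dWaveSourceTorus L U μ h).IsGroundStateVector φ) (h1 : star φ ⬝ᵥ φ = 1) (hsh : s < h) :
    (L : ℝ) ^ 2 * dWaveSourceDensity L U μ s ≤ (star φ ⬝ᵥ (pairField dWaveFormFactor L *ᵥ φ)).re := by
  have hTs : (dWaveSourceTorus L U μ s).IsHermitian :=
    dWaveSourceTorus_isHermitian L (isHermitian_hubbardTorusWith L 1 U μ) s
  -- variational principle at field `s` with trial vector `φ`
  have hvar := groundEnergy_le_rayleigh_holds hTs φ h1
  have hexp : (star φ ⬝ᵥ (dWaveSourceTorus L U μ s *ᵥ φ)).re =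
      (dWaveSourceTorus L U μ h).groundEnergy +
        (h - s) * (2 * (star φ ⬝ᵥ (pairField dWaveFormFactor L *ᵥ φ)).re) := by
    have hv : dWaveSourceTorus L U μ s *ᵥ φ = dWaveSourceTorus L U μ h *ᵥ φ +
        ((h - s : ℝ) : ℂ) • ((pairField dWaveFormFactor L + (pairField dWaveFormFactor L)ᴴ) *ᵥ φ) := by
      rw [pc_dWaveSourceTorus_shift U μ h s, add_mulVec, smul_mulVec]
    rw [hv, dotProduct_add, Complex.add_re, pc_re_expect_of_isGroundStateVector hφ h1, dotProduct_smul,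
      smul_eq_mul, Complex.re_ofReal_mul, add_mulVec, dotProduct_add, Complex.add_re,
      pc_re_conjTranspose_expect, two_mul]
  rw [hexp] at hvar
  -- tracial chord between `s` and `h`
  have hchord := dWaveSourceDensity_mul_le_groundEnergy_drop (L := L) U μ s h
  have hpos : 0 < h - s := sub_pos.2 hsh
  have key : (h - s) * (2 * ((L : ℝ) ^ 2 * dWaveSourceDensity L U μ s)) ≤
      (h - s) * (2 * (star φ ⬝ᵥ (pairField dWaveFormFactor L *ᵥ φ)).re) := by nlinarith [hvar, hchord]
  have key2 := le_of_mul_le_mul_left key hpos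
  linarith

/-- **Block coherence of a sourced ground vector.** For `0 ≤ s < h` every unit ground vector `φ` of `T_h` has
`Re⟨φ, W_R φ⟩ ≥ L² · dens_L(s)²` (`L² W_R ≥ PᴴP`, `‖Pφ‖² ≥ |⟨φ, Pφ⟩|² ≥ (L² dens_L(s))²`). [folklore] -/
theorem pc_blockCoherence_ge {R : ℕ} (hR : 0 < R) {U μ h s : ℝ} {φ : Fock (Orb (FermionTorus 2 L))}
    (hφ : (dWaveSourceTorus L U μ h).IsGroundStateVector φ) (h1 : star φ ⬝ᵥ φ = 1)
    (hs : 0 ≤ s) (hsh : s < h) :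
    (L : ℝ) ^ 2 * dWaveSourceDensity L U μ s ^ 2 ≤
      (star φ ⬝ᵥ ((((((R : ℝ) ^ 4)⁻¹ : ℝ) : ℂ) • ∑ a : TorusSite 2 L, (∑ u : Fin 2 → Fin R, localPair dWaveFormFactor L (a + fun i => ((u i : ℕ) : ZMod L)))ᴴ * (∑ u : Fin 2 → Fin R, localPair dWaveFormFactor L (a + fun i => ((u i : ℕ) : ZMod L)))) *ᵥ φ)).re := by
  have hdom := Summit.HubbardSuperconductivity.WcbcsSsbToTorusLRO.Negative.re_expect_pairIntensity_le_sq_mul_blockRepulsion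
    (L := L) R hR φ
  have hstep := pc_re_pairField_ge hφ h1 hsh
  have hdens : 0 ≤ dWaveSourceDensity L U μ s := dWaveSourceDensity_nonneg U μ hs
  -- `|⟨φ, Pφ⟩|² ≤ ‖φ‖² ‖Pφ‖² = ⟨PᴴP⟩_φ`
  set P := pairField dWaveFormFactor L with hP
  have hcs := norm_star_dotProduct_le_norm_toLp φ (P *ᵥ φ)
  have hφn : ‖(WithLp.toLp 2 φ : EuclideanSpace ℂ (Finset (Orb (FermionTorus 2 L))))‖ = 1 := by
    have h2 := norm_toLp_sq φ
    rw [h1, Complex.one_re] at h2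
    have h0 : 0 ≤ ‖(WithLp.toLp 2 φ : EuclideanSpace ℂ (Finset (Orb (FermionTorus 2 L))))‖ := norm_nonneg _
    nlinarith [h2, h0]
  have hPn : ‖(WithLp.toLp 2 (P *ᵥ φ) : EuclideanSpace ℂ (Finset (Orb (FermionTorus 2 L))))‖ ^ 2 =
      (expect (Pᴴ * P) φ).re := by
    rw [norm_toLp_sq, expect, ← mulVec_mulVec, ← star_mulVec_dotProduct]
  have hre : (star φ ⬝ᵥ (P *ᵥ φ)).re ≤ ‖star φ ⬝ᵥ (P *ᵥ φ)‖ := Complex.re_le_norm _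
  have hsq : (star φ ⬝ᵥ (P *ᵥ φ)).re ^ 2 ≤ (expect (Pᴴ * P) φ).re := by
    have h0 : 0 ≤ (star φ ⬝ᵥ (P *ᵥ φ)).re := le_trans (by positivity) hstep
    calc (star φ ⬝ᵥ (P *ᵥ φ)).re ^ 2 ≤ ‖star φ ⬝ᵥ (P *ᵥ φ)‖ ^ 2 := pow_le_pow_left₀ h0 hre 2
      _ ≤ (‖(WithLp.toLp 2 φ : EuclideanSpace ℂ _)‖ * ‖(WithLp.toLp 2 (P *ᵥ φ) : EuclideanSpace ℂ _)‖) ^ 2 :=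
          pow_le_pow_left₀ (norm_nonneg _) hcs 2
      _ = (expect (Pᴴ * P) φ).re := by rw [hφn, one_mul, hPn]
  have hL : (0 : ℝ) < (L : ℝ) ^ 2 := cast_sq_pos_of_neZero L
  -- `L⁴ dens² ≤ (Re⟨φ,Pφ⟩)² ≤ ⟨PᴴP⟩ ≤ L² ⟨W_R⟩`
  have h4 : ((L : ℝ) ^ 2 * dWaveSourceDensity L U μ s) ^ 2 ≤ (star φ ⬝ᵥ (P *ᵥ φ)).re ^ 2 :=
    pow_le_pow_left₀ (by positivity) hstep 2
  have key : (L : ℝ) ^ 2 * ((L : ℝ) ^ 2 * dWaveSourceDensity L U μ s ^ 2) ≤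
      (L : ℝ) ^ 2 * (star φ ⬝ᵥ ((((((R : ℝ) ^ 4)⁻¹ : ℝ) : ℂ) • ∑ a : TorusSite 2 L, (∑ u : Fin 2 → Fin R, localPair dWaveFormFactor L (a + fun i => ((u i : ℕ) : ZMod L)))ᴴ * (∑ u : Fin 2 → Fin R, localPair dWaveFormFactor L (a + fun i => ((u i : ℕ) : ZMod L)))) *ᵥ φ)).re := by
    calc (L : ℝ) ^ 2 * ((L : ℝ) ^ 2 * dWaveSourceDensity L U μ s ^ 2)
        = ((L : ℝ) ^ 2 * dWaveSourceDensity L U μ s) ^ 2 := by ring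
      _ ≤ (expect (Pᴴ * P) φ).re := h4.trans hsq
      _ ≤ _ := hdom
  exact le_of_mul_le_mul_left key hL

/-- **The sourced ground vector is almost a ground state of `K_μ`.** For `h ≥ 0` every unit ground vector `φ` of
`T_h` has `Re⟨φ, K_μ φ⟩ ≤ E₀(K_μ) + h · 2‖P‖`-bound with `‖P‖ ≤ (2Σ_e |d(e)/√2|)·L²`
(`⟨φ, K_μφ⟩ = E(h) + h⟨φ,(P+Pᴴ)φ⟩`, `E(h) ≤ E(0) = E₀(K_μ)`). [folklore] -/
theorem pc_re_hubbardTorusWith_le {U μ h : ℝ} (hh : 0 ≤ h) {φ : Fock (Orb (FermionTorus 2 L))}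
    (hφ : (dWaveSourceTorus L U μ h).IsGroundStateVector φ) (h1 : star φ ⬝ᵥ φ = 1) :
    (star φ ⬝ᵥ (hubbardTorusWith 2 L 1 U μ *ᵥ φ)).re ≤
      (hubbardTorusWith 2 L 1 U μ).groundEnergy +
        h * (2 * ((2 * ∑ e ∈ insert (0 : Site 2) unitSteps, |dWaveFormFactor e / Real.sqrt 2|) * (L : ℝ) ^ 2)) := by
  set P := pairField dWaveFormFactor L with hP
  have hK : hubbardTorusWith 2 L 1 U μ = dWaveSourceTorus L U μ h + (h : ℂ) • (P + Pᴴ) := by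
    rw [dWaveSourceTorus_eq, sub_add_cancel]
  have hE : (dWaveSourceTorus L U μ h).groundEnergy ≤ (hubbardTorusWith 2 L 1 U μ).groundEnergy := by
    have := groundEnergy_dWaveSourceTorus_le (L := L) U μ h
    rwa [dWaveSourceTorus_zero] at this
  -- `Re⟨φ,(P+Pᴴ)φ⟩ = 2 Re⟨φ,Pφ⟩ ≤ 2‖P‖`
  have hre : (star φ ⬝ᵥ ((P + Pᴴ) *ᵥ φ)).re ≤
      2 * ((2 * ∑ e ∈ insert (0 : Site 2) unitSteps, |dWaveFormFactor e / Real.sqrt 2|) * (L : ℝ) ^ 2) := by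
    rw [add_mulVec, dotProduct_add, Complex.add_re, pc_re_conjTranspose_expect, ← two_mul]
    refine mul_le_mul_of_nonneg_left ?_ zero_le_two
    have hφn : ‖(WithLp.toLp 2 φ : EuclideanSpace ℂ (Finset (Orb (FermionTorus 2 L))))‖ = 1 := by
      have h2 := norm_toLp_sq φ
      rw [h1, Complex.one_re] at h2
      have h0 : 0 ≤ ‖(WithLp.toLp 2 φ : EuclideanSpace ℂ (Finset (Orb (FermionTorus 2 L))))‖ := norm_nonneg _
      nlinarith [h2, h0]
    have hb := norm_star_dotProduct_mulVec_le P φ φ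
    rw [hφn, one_mul, mul_one] at hb
    exact ((Complex.re_le_norm _).trans hb).trans (norm_pairField_le dWaveFormFactor L)
  have hexp : (star φ ⬝ᵥ (hubbardTorusWith 2 L 1 U μ *ᵥ φ)).re =
      (dWaveSourceTorus L U μ h).groundEnergy + h * (star φ ⬝ᵥ ((P + Pᴴ) *ᵥ φ)).re := by
    have hv : hubbardTorusWith 2 L 1 U μ *ᵥ φ =
        dWaveSourceTorus L U μ h *ᵥ φ + (h : ℂ) • ((P + Pᴴ) *ᵥ φ) := by
      rw [hK, add_mulVec, smul_mulVec]
    rw [hv, dotProduct_add, Complex.add_re, pc_re_expect_of_isGroundStateVector hφ h1, dotProduct_smul,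
      smul_eq_mul, Complex.re_ofReal_mul]
  rw [hexp]
  nlinarith [hE, hre, hh]

/-- **Registered helper stub `stub_sourcedGroundVector`** (sub-goal of `stub_projectedChord`, line
number-projected-canonical-slope): every sourced torus `T_h` has a unit ground-state vector with `S^z ∈ {0, ½}`.
[folklore] -/
theorem stub_sourcedGroundVector :
    ∀ (L : ℕ) [NeZero L] (U μ h : ℝ), ∃ φ : Fock (Orb (FermionTorus 2 L)), (dWaveSourceTorus L U μ h).IsGroundStateVector φ ∧ star φ ⬝ᵥ φ = 1 ∧ ∃ e : ℕ, e ≤ 1 ∧ HubbardWave0.spinZ *ᵥ φ = (((e : ℝ) / 2 : ℝ) : ℂ) • φ :=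
  fun L _ U μ h => pc_exists_sourced_groundVector L U μ h

end Sourced

end Summit.HubbardSuperconductivity.HubbardSuperconductivity.Theorems

end
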